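import Summits.QuantumAdvantage.QuantumAdvantage.Theorems.CharDialPartyDialD

/-!
# PartyDial (decomp-qadv lens-5 g35), part F1 — §5a–c: free zones — separated strategies reduce to block-local ones fibre by fibre (law_of_fibres, sep_law), sepLaw_two 8/9, sepLaw_four 2/3 given `Best4Le`

See part A (`CharDialPartyDialA`) for the node header; memo `NODE-g35.md` (g35 folder of decomp-qadv-lens-5).
-/

set_option autoImplicit false
set_option linter.dupNamespace false

namespace Summit.QuantumAdvantage.QuantumAdvantage.Theorems.PartyDial

open Finset
open Summit.QuantumAdvantage.AdviceFreeQNC0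

/-! ## §5  FREE ZONES: separated strategies reduce to block-local ones (the bridge), window strategies

A strategy is `k`-SEPARATED when, after declaring an arbitrary set `B` of coordinates FREE (readable by
every cut), the remaining ACTIVE coordinates split into `k` segments of `≥ m₀` coordinates in line order,
cut `g` reading (besides `B`) only segment `pty g`, with the segments `< pty g` before it and `> pty g`
after it.  Fixing the free bits `t` and re-indexing the active coordinates turns the game into the
general game of §2 on `Fin n'` (`n' = n − #B`) with cuts `Fin (n+1)` at positions `pos g = #{active < g}`
and charges shifted by the free bits — a `k`-BLOCK-LOCAL instance; the block law applies fibre by fibre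
(`sep_law`).  Radius-`r` WINDOW strategies (cut `g` reads only `u_{g−r}, …, u_{g+r−1}`) are separated
by sacrificing `k − 1` buffers of `2r − 1` coordinates (`isSepLocal_two_of_window`,
`isSepLocal_four_of_window`), whence the WINDOW LAWS. -/

section Sep

variable {n : ℕ} (B : Finset (Fin n))

/-- the order isomorphism: reduced indices `Fin #Bᶜ` ≃ the active coordinates, in line order. -/
def act : Fin (Bᶜ.card) ≃o ((Bᶜ : Finset (Fin n)) : Set (Fin n)) := Bᶜ.orderIsoOfFin rfl

/-- the `i'`-th active coordinate. -/
def emb (i' : Fin (Bᶜ.card)) : Fin n := (act B i').1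

/-- active coordinates are not free. -/
theorem emb_not_mem (i' : Fin (Bᶜ.card)) : emb B i' ∉ B := by
  have h := (act B i').2
  rw [Finset.mem_coe, Finset.mem_compl] at h
  exact h

/-- the enumeration of the active coordinates is increasing. -/
theorem emb_strictMono : StrictMono (emb B) := fun _ _ h => (act B).strictMono h

/-- the reduced index of an active coordinate. -/
def idxA (i : Fin n) (h : i ∉ B) : Fin (Bᶜ.card) :=
  (act B).symm ⟨i, by rw [Finset.mem_coe, Finset.mem_compl]; exact h⟩

/-- `emb ∘ idxA = id`. -/
theorem emb_idxA (i : Fin n) (h : i ∉ B) : emb B (idxA B i h) = i := by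
  unfold emb idxA
  rw [OrderIso.apply_symm_apply]

/-- `idxA ∘ emb = id`. -/
theorem idxA_emb (i' : Fin (Bᶜ.card)) : idxA B (emb B i') (emb_not_mem B i') = i' := by
  unfold idxA emb
  rw [Subtype.coe_eta, OrderIso.symm_apply_apply]

/-- the POSITION of height `g` in the reduced line: the number of active coordinates below `g`. -/
def posA (g : ℕ) : ℕ := (univ.filter fun i' : Fin (Bᶜ.card) => (emb B i').val < g).card

/-- an active coordinate lies below `g` iff its reduced index lies below the reduced position of `g`. -/
theorem emb_lt_iff (i' : Fin (Bᶜ.card)) (g : ℕ) : (emb B i').val < g ↔ i'.val < posA B g := by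
  constructor
  · intro h
    have hsub : Finset.Iic i' ⊆ (univ.filter fun j' : Fin (Bᶜ.card) => (emb B j').val < g) := by
      intro j' hj'
      rw [Finset.mem_Iic] at hj'
      rw [mem_filter]
      exact ⟨mem_univ _, lt_of_le_of_lt (Fin.le_def.1 ((emb_strictMono B).monotone hj')) h⟩
    have := Finset.card_le_card hsub
    rw [Fin.card_Iic] at this
    unfold posA
    omega
  · intro h
    by_contra hge
    have hsub : (univ.filter fun j' : Fin (Bᶜ.card) => (emb B j').val < g) ⊆ Finset.Iio i' := by
      intro j' hj'
      rw [mem_filter] at hj'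
      rw [Finset.mem_Iio]
      exact (emb_strictMono B).lt_iff_lt.1 (Fin.lt_def.2 (by omega))
    have := Finset.card_le_card hsub
    rw [Fin.card_Iio] at this
    unfold posA at h
    omega

/-- counting active coordinates with a property = counting reduced indices. -/
theorem card_active (P : Fin n → Prop) [DecidablePred P] :
    (univ.filter fun i : Fin n => i ∉ B ∧ P i).card = (univ.filter fun i' : Fin (Bᶜ.card) => P (emb B i')).card := by
  rw [← Finset.card_map ⟨emb B, (emb_strictMono B).injective⟩]
  congr 1
  ext i
  simp only [mem_filter, mem_univ, true_and, Finset.mem_map, Function.Embedding.coeFn_mk]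
  constructor
  · rintro ⟨hB, hP⟩
    exact ⟨idxA B i hB, by rw [emb_idxA]; exact hP, emb_idxA B i hB⟩
  · rintro ⟨i', hP, rfl⟩
    exact ⟨emb_not_mem B i', hP⟩

/-- GLUE reduced active bits `a` with free bits `t`. -/
def glue (a : Fin (Bᶜ.card) → Bool) (t : Fin n → Bool) : Fin n → Bool :=
  fun i => if h : i ∈ B then t i else a (idxA B i h)

/-- glue at an active coordinate. -/
theorem glue_emb (a : Fin (Bᶜ.card) → Bool) (t : Fin n → Bool) (i' : Fin (Bᶜ.card)) :
    glue B a t (emb B i') = a i' := by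
  unfold glue
  rw [dif_neg (emb_not_mem B i'), idxA_emb]

/-- glue at a free coordinate. -/
theorem glue_mem (a : Fin (Bᶜ.card) → Bool) (t : Fin n → Bool) {i : Fin n} (h : i ∈ B) :
    glue B a t i = t i := by
  unfold glue
  rw [dif_pos h]

/-- gluing is injective in the active bits. -/
theorem glue_injective (t : Fin n → Bool) : Function.Injective fun a : Fin (Bᶜ.card) → Bool => glue B a t := by
  intro a a' h
  funext i'
  have h1 : glue B a t (emb B i') = glue B a' t (emb B i') := by rw [show glue B a t = glue B a' t from h]
  rwa [glue_emb, glue_emb] at h1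

/-- the free part of an input (free bits kept, active bits zeroed). -/
def freeP (u : Fin n → Bool) : Fin n → Bool := fun i => if i ∈ B then u i else false

/-- an input is the glue of its reduced active bits with its free part. -/
theorem glue_restrict (u : Fin n → Bool) : glue B (fun i' => u (emb B i')) (freeP B u) = u := by
  funext i
  unfold glue freeP
  by_cases h : i ∈ B
  · rw [dif_pos h, if_pos h]
  · rw [dif_neg h]; dsimp only; rw [emb_idxA]

/-- the free part of a glue with a free part is that free part. -/
theorem freeP_glue (a : Fin (Bᶜ.card) → Bool) (u : Fin n → Bool) :
    freeP B (glue B a (freeP B u)) = freeP B u := by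
  funext i
  by_cases h : i ∈ B
  · simp only [freeP, glue, if_pos h, dif_pos h]
  · simp only [freeP, if_neg h]

/-- a count over all coordinates splits into free and active parts. -/
theorem card_split (P : Fin n → Prop) [DecidablePred P] :
    (univ.filter fun i : Fin n => P i).card =
      (univ.filter fun i : Fin n => i ∈ B ∧ P i).card + (univ.filter fun i : Fin n => i ∉ B ∧ P i).card := by
  rw [← card_filter_add_card_filter_not (s := univ.filter fun i : Fin n => P i) (fun i => i ∈ B),
    filter_filter, filter_filter]
  congr 2
  · ext i; simp only [mem_filter, mem_univ, true_and]; tauto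
  · ext i; simp only [mem_filter, mem_univ, true_and]; tauto

/-- **Walk exponent of a glued input** = walk exponent of the active bits at the reduced position, plus
a shift depending only on the free bits and the height. -/
theorem walkExp_glue (a : Fin (Bᶜ.card) → Bool) (t : Fin n → Bool) (g : ℕ) :
    walkExp (glue B a t) g = walkExp a (posA B g) +
      ((univ.filter fun i : Fin n => i ∈ B ∧ t i = true).card +
        (univ.filter fun i : Fin n => i ∈ B ∧ (i.val < g ∧ t i = true)).card) := by
  have hw : wt (glue B a t) = (univ.filter fun i : Fin n => i ∈ B ∧ t i = true).card + wt a := by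
    unfold wt
    rw [card_split B, card_active B]
    congr 1
    · refine congrArg Finset.card (Finset.filter_congr fun i _ => ?_)
      constructor
      · rintro ⟨h, hu⟩; exact ⟨h, by rwa [glue_mem B a t h] at hu⟩
      · rintro ⟨h, ht⟩; exact ⟨h, by rwa [glue_mem B a t h]⟩
    · refine congrArg Finset.card (Finset.filter_congr fun i' _ => ?_)
      rw [glue_emb]
  have hp : wtPrefix (glue B a t) g =
      (univ.filter fun i : Fin n => i ∈ B ∧ (i.val < g ∧ t i = true)).card + wtPrefix a (posA B g) := by
    unfold wtPrefix
    rw [card_split B, card_active B]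
    congr 1
    · refine congrArg Finset.card (Finset.filter_congr fun i _ => ?_)
      constructor
      · rintro ⟨h, hl, hu⟩; exact ⟨h, hl, by rwa [glue_mem B a t h] at hu⟩
      · rintro ⟨h, hl, ht⟩; exact ⟨h, hl, by rwa [glue_mem B a t h]⟩
    · refine congrArg Finset.card (Finset.filter_congr fun i' _ => ?_)
      rw [glue_emb, emb_lt_iff]
  unfold walkExp
  rw [hw, hp]
  ring

/-- **The fibre game**: on the fibre of free part `t`, the route's game is the general game of §2 on the
reduced line (cuts `Fin (n+1)` at reduced positions, charges shifted by the free bits). -/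
theorem ringWinU_glue (c : ℕ) (y : Fin (n + 1) → (Fin n → Bool) → Bool) (a : Fin (Bᶜ.card) → Bool)
    (t : Fin n → Bool) :
    ringWinU c y (glue B a t) =
      ringWinE (fun g : Fin (n + 1) => posA B g.val)
        (fun g : Fin (n + 1) => c + g.val + ((univ.filter fun i : Fin n => i ∈ B ∧ t i = true).card +
          (univ.filter fun i : Fin n => i ∈ B ∧ (i.val < g.val ∧ t i = true)).card))
        (fun g a' => y g (glue B a' t)) a := by
  simp only [ringWinU, ringWinE]
  refine congrArg (fun s : Finset (Fin (n + 1)) => decide (s.card % 2 = 1)) (Finset.filter_congr fun g _ => ?_)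
  rw [walkExp_glue]
  constructor
  · rintro ⟨h1, h2⟩; exact ⟨h1, fun h3 => h2 (by omega)⟩
  · rintro ⟨h1, h2⟩; exact ⟨h1, fun h3 => h2 (by omega)⟩

/-- a strategy is `k`-SEPARATED with segments of `≥ m₀` active coordinates: some FREE set `B`, segment map
`sg` and party map `pty` under which cut `g` reads, outside `B`, only segment `pty g`, the segments
`< pty g` lying before it and the segments `> pty g` after it. -/
def IsSepLocal (k m₀ : ℕ) (y : Fin (n + 1) → (Fin n → Bool) → Bool) : Prop :=
  ∃ (B : Finset (Fin n)) (sg : Fin n → ℕ) (pty : Fin (n + 1) → ℕ),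
    (∀ i, i ∉ B → sg i < k) ∧ (∀ g, pty g < k) ∧
    (∀ (i : Fin n) (g : Fin (n + 1)), i ∉ B → sg i < pty g → i.val < g.val) ∧
    (∀ (i : Fin n) (g : Fin (n + 1)), i ∉ B → pty g < sg i → g.val ≤ i.val) ∧
    (∀ (g : Fin (n + 1)) (u v : Fin n → Bool), (∀ i, i ∈ B ∨ sg i = pty g → u i = v i) → y g u = y g v) ∧
    (∀ j < k, m₀ ≤ (univ.filter fun i : Fin n => i ∉ B ∧ sg i = j).card)

/-- block-local strategies are separated (empty free set). -/
theorem isSepLocal_of_isBlockLocal {k m₀ : ℕ} {y : Fin (n + 1) → (Fin n → Bool) → Bool}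
    (hy : IsBlockLocal k m₀ y) : IsSepLocal k m₀ y := by
  obtain ⟨bl, pty, hblk, hpty, hpast, hfut, hloc, hsize⟩ := hy
  refine ⟨∅, bl, pty, fun i _ => hblk i, hpty, fun i g _ h => hpast i g h, fun i g _ h => hfut i g h,
    fun g u v huv => hloc g u v (fun i hi => huv i (Or.inr hi)), fun j hj => ?_⟩
  refine (hsize j hj).trans (Finset.card_le_card fun i hi => ?_)
  rw [mem_filter] at hi ⊢
  exact ⟨hi.1, Finset.notMem_empty i, hi.2⟩

/-- separation is monotone in the segment-length threshold. -/
theorem IsSepLocal.mono {k m₀ m₁ : ℕ} {y : Fin (n + 1) → (Fin n → Bool) → Bool} (hy : IsSepLocal k m₀ y)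
    (h : m₁ ≤ m₀) : IsSepLocal k m₁ y := by
  obtain ⟨B, sg, pty, h1, h2, h3, h4, h5, h6⟩ := hy
  exact ⟨B, sg, pty, h1, h2, h3, h4, h5, fun j hj => h.trans (h6 j hj)⟩

/-- **Coarsening**: a `k`-separated strategy (`k ≥ 2`) is 2-separated — segment `0` against the union of
the others, same free zone (so the 2-separated sector contains every `k`-separated one). -/
theorem IsSepLocal.two {k m₀ : ℕ} {y : Fin (n + 1) → (Fin n → Bool) → Bool} (hy : IsSepLocal k m₀ y)
    (hk : 2 ≤ k) : IsSepLocal 2 m₀ y := by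
  obtain ⟨B, sg, pty, h1, h2, h3, h4, h5, h6⟩ := hy
  refine ⟨B, fun i => if sg i < 1 then 0 else 1, fun g => if pty g < 1 then 0 else 1,
    fun i _ => by dsimp only; split_ifs <;> omega, fun g => by dsimp only; split_ifs <;> omega,
    fun i g hi h => ?_, fun i g hi h => ?_, fun g u v huv => h5 g u v fun i hi' => huv i ?_, fun j hj => ?_⟩
  · dsimp only at h
    split_ifs at h with ha hb <;> first | omega | exact h3 i g hi (by omega)
  · dsimp only at h
    split_ifs at h with ha hb <;> first | omega | exact h4 i g hi (by omega)
  · rcases hi' with hB | hs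
    · exact Or.inl hB
    · right; dsimp only; rw [hs]
  · interval_cases j
    · refine (h6 0 (by omega)).trans (Finset.card_le_card fun i hi => ?_)
      simp only [mem_filter, mem_univ, true_and] at hi ⊢
      exact ⟨hi.1, by rw [if_pos (by omega)]⟩
    · refine (h6 1 (by omega)).trans (Finset.card_le_card fun i hi => ?_)
      simp only [mem_filter, mem_univ, true_and] at hi ⊢
      exact ⟨hi.1, by rw [if_neg (by omega)]⟩

variable {B}

/-- **Summing a fibrewise law**: if on every fibre of the free zone `B` (free bits fixed to `t`, active
bits glued in) the game wins on at most a `θ`-fraction, it wins on at most a `θ`-fraction overall. -/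
theorem law_of_fibres (θ : ℝ) (c : ℕ) (y : Fin (n + 1) → (Fin n → Bool) → Bool)
    (hfib : ∀ t : Fin n → Bool,
      ((univ.filter fun a : Fin (Bᶜ.card) → Bool => ringWinU c y (glue B a t) = true).card : ℝ) ≤
        θ * (2 : ℝ) ^ (Bᶜ.card)) :
    ((univ.filter fun u : Fin n → Bool => ringWinU c y u = true).card : ℝ) ≤ θ * (2 : ℝ) ^ n := by
  classical
  set W := univ.filter fun u : Fin n → Bool => ringWinU c y u = true with hW
  have hfibre : ∀ t ∈ univ.image (freeP B),
      (univ.filter fun u : Fin n → Bool => freeP B u = t) =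
        (univ : Finset (Fin (Bᶜ.card) → Bool)).map ⟨fun a => glue B a t, glue_injective B t⟩ := by
    intro t ht
    obtain ⟨u₀, -, rfl⟩ := mem_image.1 ht
    ext u
    simp only [mem_filter, mem_univ, true_and, Finset.mem_map, Function.Embedding.coeFn_mk]
    constructor
    · intro hu
      exact ⟨fun i' => u (emb B i'), by rw [← hu, glue_restrict]⟩
    · rintro ⟨a, rfl⟩
      exact freeP_glue B a u₀
  have hwin : ∀ t ∈ univ.image (freeP B),
      W.filter (fun u => freeP B u = t) =
        (univ.filter fun a : Fin (Bᶜ.card) → Bool => ringWinU c y (glue B a t) = true).map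
          ⟨fun a => glue B a t, glue_injective B t⟩ := by
    intro t ht
    obtain ⟨u₀, -, rfl⟩ := mem_image.1 ht
    ext u
    simp only [hW, mem_filter, mem_univ, true_and, Finset.mem_map, Function.Embedding.coeFn_mk]
    constructor
    · rintro ⟨hwu, hu⟩
      refine ⟨fun i' => u (emb B i'), ?_, ?_⟩
      · rw [← hu, glue_restrict]; exact hwu
      · rw [← hu, glue_restrict]
    · rintro ⟨a, ha, rfl⟩
      exact ⟨ha, freeP_glue B a u₀⟩
  have hcount : ∀ t ∈ univ.image (freeP B),
      ((W.filter fun u => freeP B u = t).card : ℝ) ≤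
        θ * ((univ.filter fun u : Fin n → Bool => freeP B u = t).card : ℝ) := by
    intro t ht
    rw [hwin t ht, hfibre t ht, card_map, card_map, card_univ, Fintype.card_fun, Fintype.card_bool,
      Fintype.card_fin]
    push_cast
    exact hfib t
  have h1 : (W.card : ℝ) = ∑ t ∈ univ.image (freeP B), ((W.filter fun u => freeP B u = t).card : ℝ) := by
    rw [card_eq_sum_card_fiberwise (f := freeP B) (s := W) (t := univ.image (freeP B))
      (fun u _ => mem_image_of_mem _ (mem_univ u))]
    push_cast
    rfl
  have h2 : ((2 : ℝ) ^ n) = ∑ t ∈ univ.image (freeP B),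
      ((univ.filter fun u : Fin n → Bool => freeP B u = t).card : ℝ) := by
    have := card_eq_sum_card_fiberwise (f := freeP B) (s := (univ : Finset (Fin n → Bool)))
      (t := univ.image (freeP B)) (fun u _ => mem_image_of_mem _ (mem_univ u))
    rw [card_univ, Fintype.card_fun, Fintype.card_bool, Fintype.card_fin] at this
    exact_mod_cast this
  rw [h1, h2, mul_sum]
  exact Finset.sum_le_sum hcount

/-- **The fibre law**: on each fibre of the free part, a separated strategy obeys the block law. -/
theorem fibre_law (k N : ℕ) (hN : ∀ t : Fin k → ZMod 3 → Fin 4, nWins t ≤ N) {m₀ : ℕ} (hm₀ : 1 ≤ m₀)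
    (c : ℕ) (y : Fin (n + 1) → (Fin n → Bool) → Bool) {sg : Fin n → ℕ} {pty : Fin (n + 1) → ℕ}
    (hsg : ∀ i, i ∉ B → sg i < k) (hpty : ∀ g, pty g < k)
    (hpast : ∀ (i : Fin n) (g : Fin (n + 1)), i ∉ B → sg i < pty g → i.val < g.val)
    (hfut : ∀ (i : Fin n) (g : Fin (n + 1)), i ∉ B → pty g < sg i → g.val ≤ i.val)
    (hloc : ∀ (g : Fin (n + 1)) (u v : Fin n → Bool), (∀ i, i ∈ B ∨ sg i = pty g → u i = v i) → y g u = y g v)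
    (hsize : ∀ j < k, m₀ ≤ (univ.filter fun i : Fin n => i ∉ B ∧ sg i = j).card) (t : Fin n → Bool) :
    ((univ.filter fun a : Fin (Bᶜ.card) → Bool => ringWinU c y (glue B a t) = true).card : ℝ) ≤
      (1 - ((3 : ℝ) ^ k - N) * gam m₀ ^ k) * (2 : ℝ) ^ (Bᶜ.card) := by
  have h := block_law k N hN (bl := fun i' => sg (emb B i')) (fun g : Fin (n + 1) => posA B g.val) (pty := pty)
    (fun g : Fin (n + 1) => c + g.val + ((univ.filter fun i : Fin n => i ∈ B ∧ t i = true).card +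
      (univ.filter fun i : Fin n => i ∈ B ∧ (i.val < g.val ∧ t i = true)).card))
    (fun g a' => y g (glue B a' t))
    (fun i' => hsg _ (emb_not_mem B i')) hpty
    (fun i' g h => (emb_lt_iff B i' g.val).1 (hpast _ g (emb_not_mem B i') h))
    (fun i' g h => by
      have h1 := hfut _ g (emb_not_mem B i') h
      have h2 := (emb_lt_iff B i' g.val).not.1 (by omega)
      omega)
    (fun g a a' haa => hloc g _ _ fun i hi => by
      by_cases hB : i ∈ B
      · rw [glue_mem B a t hB, glue_mem B a' t hB]
      · have hs : sg i = pty g := hi.resolve_left hB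
        have e1 := glue_emb B a t (idxA B i hB)
        have e2 := glue_emb B a' t (idxA B i hB)
        rw [emb_idxA] at e1 e2
        rw [e1, e2]
        exact haa _ (show sg (emb B (idxA B i hB)) = pty g by rw [emb_idxA]; exact hs))
    hm₀ (fun j hj => by rw [← card_active B (fun i => sg i = j)]; exact hsize j hj)
  simp only [← ringWinU_glue] at h
  exact h

/-- **THE SEPARATION LAW** (the bridge): if every profile of the `k`-party table game wins at most `N`
cells, then every `k`-separated strategy (segments `≥ m₀ ≥ 1`, any free zone) wins the route's game on
at most `(1 − (3^k − N)·γ(m₀)^k)·2ⁿ` inputs — every `n`, every charge, no degree hypothesis. -/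
theorem sep_law (k N : ℕ) (hN : ∀ t : Fin k → ZMod 3 → Fin 4, nWins t ≤ N) {m₀ : ℕ} (hm₀ : 1 ≤ m₀)
    (c : ℕ) (y : Fin (n + 1) → (Fin n → Bool) → Bool) (hy : IsSepLocal k m₀ y) :
    ((univ.filter fun u : Fin n → Bool => ringWinU c y u = true).card : ℝ) ≤
      (1 - ((3 : ℝ) ^ k - N) * gam m₀ ^ k) * (2 : ℝ) ^ n := by
  obtain ⟨B, sg, pty, hsg, hpty, hpast, hfut, hloc, hsize⟩ := hy
  exact law_of_fibres (B := B) _ c y fun t => fibre_law k N hN hm₀ c y hsg hpty hpast hfut hloc hsize t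

/-- **SEPARATED TWO-SEGMENT LAW** (`8/9`): every 2-separated strategy wins on `≤ (1 − γ(m₀)²)·2ⁿ`. -/
theorem sepLaw_two {m₀ : ℕ} (hm₀ : 1 ≤ m₀) (c : ℕ) (y : Fin (n + 1) → (Fin n → Bool) → Bool)
    (hy : IsSepLocal 2 m₀ y) :
    ((univ.filter fun u : Fin n → Bool => ringWinU c y u = true).card : ℝ) ≤
      (1 - gam m₀ ^ 2) * (2 : ℝ) ^ n := by
  have h := sep_law 2 8 nWins_two_le hm₀ c y hy
  norm_num at h
  exact h

end Sep

end Summit.QuantumAdvantage.QuantumAdvantage.Theorems.PartyDial
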